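import Mathlib
import HarnessLib
import Summits.HubbardSuperconductivity.HubbardSuperconductivity.Theorems.KLProgrammeKLRegimeEngineTowerProfiles

/-!
# Route `KLProgramme` — crux K3, VL child `KLRegimeVolumeLimitV17F3` (stmt-HubbardSuperconductivity-23356), producer route «(VL)-SRC-SOFT» §T2ε:
# THE BLOCK STEP IN CLOSED FORM FOR A PROFILE THAT IS ε-SMALL IN DEGREE TWO (seat hubbard-kl-k3c4-p1 g19; `--supports` 23356)

E1's (T2) `…EngineTowerBookkeeping.towerStep_le_profile` turns the kit's step right side (`towerFO + Σ_{n=2}^{N} e Φ^{n−1} ψ^p towerS_n + tail`) into the closed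
form `A′ λ^{p−1}[…]` for inputs with the GEOMETRIC profile `μ m ≤ A′ λ^{m−1} Q′^m`, under the amplitude conditions `y = 2A′ΦτQ′ < 1`, `θ̄ = ΦA′eτQ′/(1−x₃) < 1`.
The producer route reads its alive inputs from `stub_vl_HE1free`, whose law `C₀·klWtBudget P Q₁ U (j+1) (2m) = C₀·CE^m·ε^{max(1,m−1)}·(units)` carries ONE MORE `ε` in
degree two than the geometric profile can see, and whose amplitude `A′ ≍ C₀` is NOT small (so `y ≮ 1` for T2 verbatim).  This file is the variant for the profile

  `μ m ≤ A′ · λ^{max(1, m−1)} · Q′^m`   (`1 ≤ m ≤ D`, `λ ≤ 1`),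

in which EVERY input vertex is `λ`-small: the field norm obeys `towerV ≤ A′·λ·w₀` (`w₀ = eτQ′(1 + eτQ′/(1−x₃))`, **`towerV_le_eps`**), so the guard `Φ·towerV < 1` and the
tail need no amplitude condition; the graded orders `2 ≤ n ≤ p` keep the perturbative order `λ^{p−1}` exactly (E1's `towerS_le`, finitely many orders, their constants
`(2ΦA′τQ′)^{n−1}` go into the per-pair constant), and the orders `n ≥ p+1` are read through the SAME `towerS_le` at the profile `A′·(√λ·Q′)^m`
(`λ^{max(1,m−1)} ≤ λ^{m/2}`), which carries `λ^{(p+n−1)/2} = λ^{p}·(√λ)^{n−1−p}`: one spare `√λ` per extra vertex (ratio `z = 2ΦA′τQ′√λ ≤ ½`).  Result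
(**`towerStep_le_profile_eps`**): under `λ ≤ 1`, `4σλQ′ ≤ ½`, `eτλQ′ ≤ ½`, `2τ√λQ′ ≤ 1`, `2ΦA′τQ′√λ ≤ ½`, `ΦA′λw₀ ≤ ½`,

  `b ≤ A′ · λ^{max(1,p−1)} · [ (4Q′)^p·8σQ′ + p·e·(2τψQ′)^p·M^{p−1} + 2e·(2τψQ′)^p·M^p ]`,  `M = max 1 (2ΦA′τQ′)`

(the tail removed by `N → ∞` as in T2) — the output has the law shape `λ^{max(1,p−1)}·(per-pair constant)^p` with the INPUT amplitude `A′` as a linear factor,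
which is what a β-soft source-species tower needs (its amplitude is quantified after β; only the shape in the degree is owed).
* `profile_of_profile_eps`, `profile_sqrt_of_profile_eps` — the two geometric profiles dominated by the ε-profile;
* `towerV_le_eps`; `sum_Icc_filter_gt_pow_le` (a shifted geometric sum); **`towerStep_le_profile_eps`**.

Pure real analysis; nothing about the model is asserted; nothing asserts any stub, VL, K3 or superconductivity.
References: BGM 2006 §2.8 (2.83), §2.9 (4.3)–(4.8), §3 (3.2)–(3.8) [cite: BenfattoGiulianiMastropietro2006]; Gawȩdzki–Kupiainen 1985 §3.
-/

noncomputable section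

namespace Summit.HubbardSuperconductivity.HubbardSuperconductivity.Theorems.TwoVolumeDefect

set_option linter.dupNamespace false -- summit = problem name (single-conjunct summit), D-0017

open Real Finset
open Summit.HubbardSuperconductivity.HubbardSuperconductivity.Theorems.EngineV8

/-! ## §1 The ε-profile dominates two geometric profiles -/

/-- `λ^{max(1,m−1)} ≤ λ^{m−1}` for `0 ≤ λ ≤ 1`. -/
theorem pow_max_one_le_pow_sub_one {lam : ℝ} (hlam : 0 ≤ lam) (hlam1 : lam ≤ 1) (m : ℕ) : lam ^ max 1 (m - 1) ≤ lam ^ (m - 1) :=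
  pow_le_pow_of_le_one hlam hlam1 (le_max_right _ _)

/-- `λ^{max(1,m−1)} ≤ (√λ)^m` for `0 ≤ λ ≤ 1`, `1 ≤ m` (`m ≤ 2·max(1,m−1)`). -/
theorem pow_max_one_le_sqrt_pow {lam : ℝ} (hlam : 0 ≤ lam) (hlam1 : lam ≤ 1) {m : ℕ} (hm : 1 ≤ m) :
    lam ^ max 1 (m - 1) ≤ Real.sqrt lam ^ m := by
  have hs0 : 0 ≤ Real.sqrt lam := Real.sqrt_nonneg lam
  have hs1 : Real.sqrt lam ≤ 1 := by have h := Real.sqrt_le_sqrt hlam1; rwa [Real.sqrt_one] at h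
  have hsq : Real.sqrt lam ^ 2 = lam := Real.sq_sqrt hlam
  calc lam ^ max 1 (m - 1) = Real.sqrt lam ^ (2 * max 1 (m - 1)) := by rw [pow_mul, hsq]
    _ ≤ Real.sqrt lam ^ m := pow_le_pow_of_le_one hs0 hs1 (by omega)

/-- **The ε-profile dominates T2's geometric profile** (`λ ≤ 1`): `μ m ≤ A′ λ^{m−1} Q′^m`. -/
theorem profile_of_profile_eps {D : ℕ} {μ : ℕ → ℝ} {A' lam Q' : ℝ} (hA' : 0 ≤ A') (hlam : 0 ≤ lam) (hlam1 : lam ≤ 1) (hQ' : 0 ≤ Q')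
    (hprof : ∀ m, 1 ≤ m → m ≤ D → μ m ≤ A' * lam ^ max 1 (m - 1) * Q' ^ m) :
    ∀ m, 1 ≤ m → m ≤ D → μ m ≤ A' * lam ^ (m - 1) * Q' ^ m := fun m hm hmD =>
  (hprof m hm hmD).trans (by have := pow_max_one_le_pow_sub_one hlam hlam1 m; gcongr)

/-- **The ε-profile dominates the geometric profile at the ratio `√λ·Q′` with `λ`-free exponent** (`λ ≤ 1`): `μ m ≤ A′ · 1^{m−1} · (√λ Q′)^m`. -/
theorem profile_sqrt_of_profile_eps {D : ℕ} {μ : ℕ → ℝ} {A' lam Q' : ℝ} (hA' : 0 ≤ A') (hlam : 0 ≤ lam) (hlam1 : lam ≤ 1) (hQ' : 0 ≤ Q')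
    (hprof : ∀ m, 1 ≤ m → m ≤ D → μ m ≤ A' * lam ^ max 1 (m - 1) * Q' ^ m) :
    ∀ m, 1 ≤ m → m ≤ D → μ m ≤ A' * (1 : ℝ) ^ (m - 1) * (Real.sqrt lam * Q') ^ m := by
  intro m hm hmD
  refine (hprof m hm hmD).trans ?_
  rw [one_pow, mul_one, mul_pow, ← mul_assoc]
  have := pow_max_one_le_sqrt_pow hlam hlam1 hm
  gcongr

/-! ## §2 The field norm of an ε-profile is `λ`-small -/

/-- `Σ_{m ∈ Ioc 1 D} x^{m−2} ≤ 1/(1−x)` for `0 ≤ x < 1`. -/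
theorem sum_Ioc_one_pow_sub_two_le {x : ℝ} (hx0 : 0 ≤ x) (hx1 : x < 1) (D : ℕ) :
    ∑ m ∈ Ioc 1 D, x ^ (m - 2) ≤ 1 / (1 - x) := by
  have hI : Ioc 1 D = Ico 2 (D + 1) := by ext m; simp only [mem_Ioc, mem_Ico]; omega
  rw [hI, sum_Ico_eq_sum_range]
  have h := geom_sum_Ico_le_of_lt_one hx0 hx1 (m := 0) (n := D + 1 - 2)
  rw [pow_zero, ← range_eq_Ico] at h
  refine le_trans (le_of_eq (sum_congr rfl fun i _ => ?_)) h
  congr 1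
  omega

/-- **The field-weighted norm of an ε-profile**: `towerV ≤ A′·λ·eτQ′·(1 + eτQ′/(1 − eτλQ′))` (`x₃ = eτλQ′ < 1`) — every vertex carries a `λ`. -/
theorem towerV_le_eps {D : ℕ} {τ A' lam Q' : ℝ} {μ : ℕ → ℝ} (hτ : 0 ≤ τ) (hA' : 0 ≤ A') (hlam : 0 ≤ lam) (hQ' : 0 ≤ Q')
    (hμ0 : ∀ m, 0 ≤ μ m) (hprof : ∀ m, 1 ≤ m → m ≤ D → μ m ≤ A' * lam ^ max 1 (m - 1) * Q' ^ m)
    (hx₃ : exp 1 * τ * lam * Q' < 1) :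
    towerV D τ μ ≤ A' * lam * (exp 1 * τ * Q') * (1 + exp 1 * τ * Q' / (1 - exp 1 * τ * lam * Q')) := by
  have hx0 : 0 ≤ exp 1 * τ * lam * Q' := by positivity
  unfold towerV
  by_cases hD : D = 0
  · subst hD
    rw [show Icc 1 0 = (∅ : Finset ℕ) by rfl, sum_empty]
    have : 0 ≤ 1 - exp 1 * τ * lam * Q' := by linarith
    positivity
  have hD1 : 1 ≤ D := Nat.one_le_iff_ne_zero.2 hD
  -- split off the degree-two term
  have hsplit : Icc 1 D = insert 1 (Ioc 1 D) := by ext m; simp only [mem_Icc, mem_insert, mem_Ioc]; omega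
  have hnot : (1 : ℕ) ∉ Ioc 1 D := by simp
  rw [hsplit, sum_insert hnot]
  -- the degree-two term
  have h1 : (exp 1 * τ) ^ 1 * μ 1 ≤ A' * lam * (exp 1 * τ * Q') := by
    have hμ := hprof 1 le_rfl hD1
    have hμ0' := hμ0 1
    have hmax : max 1 (1 - 1) = 1 := by norm_num
    rw [hmax, pow_one, pow_one] at hμ
    rw [pow_one]
    calc exp 1 * τ * μ 1 ≤ exp 1 * τ * (A' * lam * Q') := by gcongr
      _ = A' * lam * (exp 1 * τ * Q') := by ring
  -- the higher degrees: a geometric series in `x₃` with one more `eτQ′`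
  have hterm : ∀ m ∈ Ioc 1 D, (exp 1 * τ) ^ m * μ m ≤
      A' * lam * (exp 1 * τ * Q') * (exp 1 * τ * Q') * (exp 1 * τ * lam * Q') ^ (m - 2) := by
    intro m hm
    rw [mem_Ioc] at hm
    have hμ := hprof m (by omega) hm.2
    have hmax : max 1 (m - 1) = m - 1 := max_eq_right (by omega)
    rw [hmax] at hμ
    have hμ0' := hμ0 m
    calc (exp 1 * τ) ^ m * μ m ≤ (exp 1 * τ) ^ m * (A' * lam ^ (m - 1) * Q' ^ m) := by gcongr
      _ = A' * lam * (exp 1 * τ * Q') * (exp 1 * τ * Q') * (exp 1 * τ * lam * Q') ^ (m - 2) := by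
          obtain ⟨j, rfl⟩ : ∃ j, m = j + 2 := ⟨m - 2, by omega⟩
          simp only [Nat.add_sub_cancel, show j + 2 - 1 = j + 1 by omega, pow_succ, mul_pow]
          ring
  have hsum : ∑ m ∈ Ioc 1 D, (exp 1 * τ) ^ m * μ m ≤
      A' * lam * (exp 1 * τ * Q') * (exp 1 * τ * Q') * (1 / (1 - exp 1 * τ * lam * Q')) := by
    refine (sum_le_sum hterm).trans ?_
    rw [← mul_sum]
    exact mul_le_mul_of_nonneg_left (sum_Ioc_one_pow_sub_two_le hx0 hx₃ D) (by positivity)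
  calc (exp 1 * τ) ^ 1 * μ 1 + ∑ m ∈ Ioc 1 D, (exp 1 * τ) ^ m * μ m
      ≤ A' * lam * (exp 1 * τ * Q') + A' * lam * (exp 1 * τ * Q') * (exp 1 * τ * Q') * (1 / (1 - exp 1 * τ * lam * Q')) :=
        add_le_add h1 hsum
    _ = A' * lam * (exp 1 * τ * Q') * (1 + exp 1 * τ * Q' / (1 - exp 1 * τ * lam * Q')) := by ring

/-! ## §3 The block step in closed form for an ε-profile -/

/-- A shifted finite geometric sum: `Σ_{n ∈ Icc 2 N, p < n} z^{n−1−p} ≤ 1/(1−z)` (`0 ≤ z < 1`). -/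
theorem sum_Icc_filter_gt_pow_le {z : ℝ} (hz0 : 0 ≤ z) (hz1 : z < 1) (N p : ℕ) :
    ∑ n ∈ (Icc 2 N).filter (fun n => p < n), z ^ (n - 1 - p) ≤ 1 / (1 - z) := by
  have hsub : (Icc 2 N).filter (fun n => p < n) ⊆ Ico (p + 1) (N + 1) := by
    intro n hn
    rw [mem_filter, mem_Icc] at hn
    rw [mem_Ico]; omega
  refine (sum_le_sum_of_subset_of_nonneg hsub fun n _ _ => pow_nonneg hz0 _).trans ?_
  rw [sum_Ico_eq_sum_range]
  have h := geom_sum_Ico_le_of_lt_one hz0 hz1 (m := 0) (n := N + 1 - (p + 1))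
  rw [pow_zero, ← range_eq_Ico] at h
  refine le_trans (le_of_eq (sum_congr rfl fun i _ => ?_)) h
  congr 1
  omega

/-- **(T2ε) THE BLOCK STEP FOR AN ε-PROFILE, IN CLOSED FORM.**  Inputs `0 ≤ μ m ≤ A′ λ^{max(1,m−1)} Q′^m` on `[1, D]` (`0 ≤ λ ≤ 1`); the step hypothesis
for the output size `b` in degree `2p` (`1 ≤ p`) in the kit's form — for every cumulant order `N ≥ 2`, under the guard `Φ·V < 1`:
`b ≤ FO(p) + Σ_{n=2}^{N} e Φ^{n−1} ψ^p S_n(p) + ψ^p e V (ΦV)^N/(1 − ΦV)`; and the `λ`-smallness rows `4σλQ′ ≤ ½`, `eτλQ′ ≤ ½`, `2τ√λQ′ ≤ 1`,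
`2ΦA′τQ′√λ ≤ ½`, `Φ·A′λ·eτQ′(1 + 2eτQ′) ≤ ½` (NO condition on the amplitude `A′Q′` alone).  Then, with `M = max 1 (2ΦA′τQ′)`,
`b ≤ A′ λ^{max(1,p−1)} [(4Q′)^p·8σQ′ + p·e·(2τψQ′)^p·M^{p−1} + 2e·(2τψQ′)^p·M^p]`. [cite: BenfattoGiulianiMastropietro2006, §2.8 (2.83), §2.9 (4.3)-(4.8)] -/
theorem towerStep_le_profile_eps {D : ℕ} {μ : ℕ → ℝ} {b σ Φ ψ τ A' lam Q' : ℝ}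
    (hσ : 0 ≤ σ) (hΦ : 0 ≤ Φ) (hψ : 0 ≤ ψ) (hτ : 0 ≤ τ) (hA' : 0 ≤ A') (hlam : 0 ≤ lam) (hlam1 : lam ≤ 1) (hQ' : 0 ≤ Q')
    (hμ0 : ∀ m, 0 ≤ μ m) (hprof : ∀ m, 1 ≤ m → m ≤ D → μ m ≤ A' * lam ^ max 1 (m - 1) * Q' ^ m)
    (hx₁ : 4 * σ * lam * Q' ≤ 1 / 2) (hx₃ : exp 1 * τ * lam * Q' ≤ 1 / 2) (hxs : 2 * τ * Real.sqrt lam * Q' ≤ 1)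
    (hz : 2 * Φ * A' * τ * Q' * Real.sqrt lam ≤ 1 / 2)
    (hV : Φ * (A' * lam * (exp 1 * τ * Q') * (1 + 2 * (exp 1 * τ * Q'))) ≤ 1 / 2)
    {p : ℕ} (hp : 1 ≤ p)
    (hstep : ∀ N : ℕ, 2 ≤ N → Φ * towerV D τ μ < 1 →
      b ≤ towerFO D σ μ p + ∑ n ∈ Icc 2 N, exp 1 * Φ ^ (n - 1) * ψ ^ p * towerS D τ μ n p +
        ψ ^ p * exp 1 * towerV D τ μ * (Φ * towerV D τ μ) ^ N / (1 - Φ * towerV D τ μ)) :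
    b ≤ A' * lam ^ max 1 (p - 1) * ((4 * Q') ^ p * (8 * σ * Q') +
      p * exp 1 * (2 * τ * ψ * Q') ^ p * max 1 (2 * Φ * A' * τ * Q') ^ (p - 1) +
      2 * exp 1 * (2 * τ * ψ * Q') ^ p * max 1 (2 * Φ * A' * τ * Q') ^ p) := by
  -- abbreviations and the two dominated geometric profiles
  set M := max 1 (2 * Φ * A' * τ * Q') with hMdef
  have hM1 : 1 ≤ M := le_max_left _ _
  have hM0 : 0 ≤ M := zero_le_one.trans hM1
  have hMge : 2 * Φ * A' * τ * Q' ≤ M := le_max_right _ _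
  have hs0 : 0 ≤ Real.sqrt lam := Real.sqrt_nonneg lam
  have hprof₁ := profile_of_profile_eps (D := D) (μ := μ) hA' hlam hlam1 hQ' hprof
  have hprof₂ := profile_sqrt_of_profile_eps (D := D) (μ := μ) hA' hlam hlam1 hQ' hprof
  have hx₁lt : 4 * σ * lam * Q' < 1 := by linarith
  have hx₃lt : exp 1 * τ * lam * Q' < 1 := by linarith
  have hlam_le_sqrt : lam ≤ Real.sqrt lam := by
    have h := Real.sqrt_le_sqrt hlam1
    calc lam = Real.sqrt lam * Real.sqrt lam := (Real.mul_self_sqrt hlam).symm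
      _ ≤ Real.sqrt lam * 1 := by rw [Real.sqrt_one] at h; exact mul_le_mul_of_nonneg_left h hs0
      _ = Real.sqrt lam := mul_one _
  have hx₂ : 2 * lam * τ * Q' ≤ 1 := by
    calc 2 * lam * τ * Q' = lam * (2 * τ * Q') := by ring
      _ ≤ Real.sqrt lam * (2 * τ * Q') := mul_le_mul_of_nonneg_right hlam_le_sqrt (by positivity)
      _ = 2 * τ * Real.sqrt lam * Q' := by ring
      _ ≤ 1 := hxs
  have hx₂' : 2 * (1 : ℝ) * τ * (Real.sqrt lam * Q') ≤ 1 := by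
    calc 2 * (1 : ℝ) * τ * (Real.sqrt lam * Q') = 2 * τ * Real.sqrt lam * Q' := by ring
      _ ≤ 1 := hxs
  -- the field norm and the guard
  set w₀ : ℝ := exp 1 * τ * Q' * (1 + exp 1 * τ * Q' / (1 - exp 1 * τ * lam * Q')) with hw₀
  set V := towerV D τ μ with hVdef
  have hV0 : 0 ≤ V := towerV_nonneg hτ hμ0
  have hVle : V ≤ A' * lam * (exp 1 * τ * Q') * (1 + exp 1 * τ * Q' / (1 - exp 1 * τ * lam * Q')) :=
    towerV_le_eps hτ hA' hlam hQ' hμ0 hprof hx₃lt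
  have hw₀le : 1 + exp 1 * τ * Q' / (1 - exp 1 * τ * lam * Q') ≤ 1 + 2 * (exp 1 * τ * Q') := by
    have h1 : (0 : ℝ) < 1 - exp 1 * τ * lam * Q' := by linarith
    have h2 : exp 1 * τ * Q' / (1 - exp 1 * τ * lam * Q') ≤ exp 1 * τ * Q' / (1 / 2) :=
      div_le_div_of_nonneg_left (by positivity) (by norm_num) (by linarith)
    linarith
  have hΦV : Φ * V ≤ 1 / 2 := by
    calc Φ * V ≤ Φ * (A' * lam * (exp 1 * τ * Q') * (1 + exp 1 * τ * Q' / (1 - exp 1 * τ * lam * Q'))) :=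
          mul_le_mul_of_nonneg_left hVle hΦ
      _ ≤ Φ * (A' * lam * (exp 1 * τ * Q') * (1 + 2 * (exp 1 * τ * Q'))) := by gcongr
      _ ≤ 1 / 2 := hV
  have hθ1 : Φ * V < 1 := by linarith
  have hθ0 : 0 ≤ Φ * V := mul_nonneg hΦ hV0
  -- (i) first order
  have hFO : towerFO D σ μ p ≤ A' * lam ^ max 1 (p - 1) * ((4 * Q') ^ p * (8 * σ * Q')) := by
    have h := towerFO_le hσ hA' hlam hQ' hμ0 hprof₁ hx₁lt hp (D := D)
    have hfrac : 4 * σ * lam * Q' / (1 - 4 * σ * lam * Q') ≤ lam * (8 * σ * Q') := by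
      rw [div_le_iff₀ (by linarith)]
      have hx0 : 0 ≤ 4 * σ * lam * Q' := by positivity
      have h12 : (1 : ℝ) / 2 ≤ 1 - 4 * σ * lam * Q' := by linarith
      calc 4 * σ * lam * Q' = (lam * (8 * σ * Q')) * (1 / 2) := by ring
        _ ≤ (lam * (8 * σ * Q')) * (1 - 4 * σ * lam * Q') := mul_le_mul_of_nonneg_left h12 (by positivity)
    have hpow : lam ^ (p - 1) * lam ≤ lam ^ max 1 (p - 1) := by
      rw [← pow_succ, show p - 1 + 1 = p by omega]
      exact pow_le_pow_of_le_one hlam hlam1 (by omega)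
    calc towerFO D σ μ p ≤ A' * lam ^ (p - 1) * (4 * Q') ^ p * (4 * σ * lam * Q' / (1 - 4 * σ * lam * Q')) := h
      _ ≤ A' * lam ^ (p - 1) * (4 * Q') ^ p * (lam * (8 * σ * Q')) := by gcongr
      _ = A' * (lam ^ (p - 1) * lam) * ((4 * Q') ^ p * (8 * σ * Q')) := by ring
      _ ≤ A' * lam ^ max 1 (p - 1) * ((4 * Q') ^ p * (8 * σ * Q')) := by gcongr
  -- (ii) graded orders `n ≤ p`: T2's `towerS_le` keeps `λ^{p−1}`
  have hlow : ∀ N, ∑ n ∈ (Icc 2 N).filter (fun n => n ≤ p), exp 1 * Φ ^ (n - 1) * ψ ^ p * towerS D τ μ n p ≤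
      A' * lam ^ max 1 (p - 1) * (p * exp 1 * (2 * τ * ψ * Q') ^ p * M ^ (p - 1)) := by
    intro N
    have hterm : ∀ n ∈ (Icc 2 N).filter (fun n => n ≤ p), exp 1 * Φ ^ (n - 1) * ψ ^ p * towerS D τ μ n p ≤
        A' * lam ^ max 1 (p - 1) * (exp 1 * (2 * τ * ψ * Q') ^ p * M ^ (p - 1)) := by
      intro n hn
      rw [mem_filter, mem_Icc] at hn
      obtain ⟨⟨hn2, -⟩, hnp⟩ := hn
      have hp2 : 2 ≤ p := hn2.trans hnp
      have hmax : max 1 (p - 1) = p - 1 := max_eq_right (by omega)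
      have hS := towerS_le hτ hA' hlam hQ' hμ0 hprof₁ hx₂ (by omega : 1 ≤ n) hp (D := D)
      have hS0 := towerS_nonneg hτ hμ0 n p (D := D)
      calc exp 1 * Φ ^ (n - 1) * ψ ^ p * towerS D τ μ n p
          ≤ exp 1 * Φ ^ (n - 1) * ψ ^ p * (A' ^ n * lam ^ (p - 1) * (2 * τ * Q') ^ (p + n - 1)) := by gcongr
        _ = A' * lam ^ (p - 1) * (exp 1 * (2 * τ * ψ * Q') ^ p * (2 * Φ * A' * τ * Q') ^ (n - 1)) := by
            obtain ⟨j, rfl⟩ : ∃ j, n = j + 1 := ⟨n - 1, by omega⟩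
            have hpj : p + (j + 1) - 1 = p + j := by omega
            rw [hpj, Nat.add_sub_cancel, pow_add, pow_succ, mul_pow, mul_pow, mul_pow, mul_pow, mul_pow, mul_pow, mul_pow]
            ring
        _ ≤ A' * lam ^ (p - 1) * (exp 1 * (2 * τ * ψ * Q') ^ p * M ^ (p - 1)) := by
            have h1 : (2 * Φ * A' * τ * Q') ^ (n - 1) ≤ M ^ (n - 1) := pow_le_pow_left₀ (by positivity) hMge _
            have h2 : M ^ (n - 1) ≤ M ^ (p - 1) := pow_le_pow_right₀ hM1 (by omega)
            gcongr
            exact h1.trans h2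
        _ = A' * lam ^ max 1 (p - 1) * (exp 1 * (2 * τ * ψ * Q') ^ p * M ^ (p - 1)) := by rw [hmax]
    refine (sum_le_sum hterm).trans ?_
    rw [sum_const, nsmul_eq_mul]
    have hcard : (((Icc 2 N).filter (fun n => n ≤ p)).card : ℝ) ≤ p := by
      have h : (Icc 2 N).filter (fun n => n ≤ p) ⊆ Icc 1 p := by
        intro n hn; rw [mem_filter, mem_Icc] at hn; rw [mem_Icc]; omega
      have := card_le_card h
      rw [Nat.card_Icc] at this
      exact_mod_cast (this.trans (by omega))
    calc (((Icc 2 N).filter (fun n => n ≤ p)).card : ℝ) * (A' * lam ^ max 1 (p - 1) * (exp 1 * (2 * τ * ψ * Q') ^ p * M ^ (p - 1)))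
        ≤ p * (A' * lam ^ max 1 (p - 1) * (exp 1 * (2 * τ * ψ * Q') ^ p * M ^ (p - 1))) :=
          mul_le_mul_of_nonneg_right hcard (by positivity)
      _ = A' * lam ^ max 1 (p - 1) * (p * exp 1 * (2 * τ * ψ * Q') ^ p * M ^ (p - 1)) := by ring
  -- (ii′) graded orders `n ≥ p+1`: `towerS_le` at the profile `A′(√λ Q′)^m` carries `λ^{(p+n−1)/2}`
  have hhigh : ∀ N, ∑ n ∈ (Icc 2 N).filter (fun n => p < n), exp 1 * Φ ^ (n - 1) * ψ ^ p * towerS D τ μ n p ≤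
      A' * lam ^ max 1 (p - 1) * (2 * exp 1 * (2 * τ * ψ * Q') ^ p * M ^ p) := by
    intro N
    set z : ℝ := 2 * Φ * A' * τ * Q' * Real.sqrt lam with hzdef
    have hz0 : 0 ≤ z := by positivity
    have hz1 : z < 1 := by linarith
    have hterm : ∀ n ∈ (Icc 2 N).filter (fun n => p < n), exp 1 * Φ ^ (n - 1) * ψ ^ p * towerS D τ μ n p ≤
        A' * lam ^ p * (exp 1 * (2 * τ * ψ * Q') ^ p * M ^ p) * z ^ (n - 1 - p) := by
      intro n hn
      rw [mem_filter, mem_Icc] at hn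
      obtain ⟨⟨hn2, -⟩, hnp⟩ := hn
      have hS := towerS_le hτ hA' zero_le_one (mul_nonneg hs0 hQ') hμ0 hprof₂ hx₂' (by omega : 1 ≤ n) hp (D := D)
      have hS0 := towerS_nonneg hτ hμ0 n p (D := D)
      have hsq : Real.sqrt lam ^ 2 = lam := Real.sq_sqrt hlam
      calc exp 1 * Φ ^ (n - 1) * ψ ^ p * towerS D τ μ n p
          ≤ exp 1 * Φ ^ (n - 1) * ψ ^ p * (A' ^ n * (1 : ℝ) ^ (p - 1) * (2 * τ * (Real.sqrt lam * Q')) ^ (p + n - 1)) := by gcongr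
        _ = A' * lam ^ p * (exp 1 * (2 * τ * ψ * Q') ^ p * (2 * Φ * A' * τ * Q') ^ p) * z ^ (n - 1 - p) := by
            obtain ⟨j, rfl⟩ : ∃ j, n = p + 1 + j := ⟨n - (p + 1), by omega⟩
            have h1 : p + (p + 1 + j) - 1 = 2 * p + j := by omega
            have h2 : p + 1 + j - 1 = p + j := by omega
            rw [h1, h2, Nat.add_sub_cancel_left, hzdef, one_pow, mul_one]
            -- generalise the square root
            have hsl : Real.sqrt lam ^ (2 * p + j) = lam ^ p * Real.sqrt lam ^ j := by
              rw [pow_add, pow_mul, hsq]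
            set sl := Real.sqrt lam with hsl'
            have hA : A' ^ (p + 1 + j) = A' * A' ^ p * A' ^ j := by
              rw [show p + 1 + j = 1 + p + j by omega, pow_add, pow_add, pow_one]
            have hΦp : Φ ^ (p + j) = Φ ^ p * Φ ^ j := pow_add _ _ _
            have hT : (2 * τ * (sl * Q')) ^ (2 * p + j) = (2 * τ * Q') ^ p * (2 * τ * Q') ^ p * (2 * τ * Q') ^ j * (lam ^ p * sl ^ j) := by
              rw [show 2 * τ * (sl * Q') = (2 * τ * Q') * sl by ring, mul_pow, hsl, pow_add, show (2 : ℕ) * p = p + p from two_mul p,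
                pow_add]
            rw [hA, hΦp, hT, mul_pow (2 * τ * ψ) Q', mul_pow (2 * τ) ψ, mul_pow (2 * τ) Q', mul_pow (2 * Φ * A' * τ * Q') sl,
              mul_pow (2 * Φ * A' * τ) Q', mul_pow (2 * Φ * A') τ, mul_pow (2 * Φ) A', mul_pow 2 Φ, mul_pow 2 τ]
            ring
        _ ≤ A' * lam ^ p * (exp 1 * (2 * τ * ψ * Q') ^ p * M ^ p) * z ^ (n - 1 - p) := by
            have h1 : (2 * Φ * A' * τ * Q') ^ p ≤ M ^ p := pow_le_pow_left₀ (by positivity) hMge _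
            gcongr
    refine (sum_le_sum hterm).trans ?_
    rw [← mul_sum]
    have hgeo := sum_Icc_filter_gt_pow_le hz0 hz1 N p
    have h2 : 1 / (1 - z) ≤ 2 := by
      rw [div_le_iff₀ (by linarith)]; linarith
    have hpow : lam ^ p ≤ lam ^ max 1 (p - 1) := pow_le_pow_of_le_one hlam hlam1 (by omega)
    have hE0 : 0 ≤ exp 1 * (2 * τ * ψ * Q') ^ p * M ^ p := by positivity
    have hS0 : 0 ≤ ∑ n ∈ (Icc 2 N).filter (fun n => p < n), z ^ (n - 1 - p) := sum_nonneg fun n _ => pow_nonneg hz0 _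
    have hS2 : ∑ n ∈ (Icc 2 N).filter (fun n => p < n), z ^ (n - 1 - p) ≤ 2 := hgeo.trans h2
    have hL : A' * lam ^ p * (exp 1 * (2 * τ * ψ * Q') ^ p * M ^ p) ≤ A' * lam ^ max 1 (p - 1) * (exp 1 * (2 * τ * ψ * Q') ^ p * M ^ p) :=
      mul_le_mul_of_nonneg_right (mul_le_mul_of_nonneg_left hpow hA') hE0
    calc A' * lam ^ p * (exp 1 * (2 * τ * ψ * Q') ^ p * M ^ p) * ∑ n ∈ (Icc 2 N).filter (fun n => p < n), z ^ (n - 1 - p)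
        ≤ A' * lam ^ max 1 (p - 1) * (exp 1 * (2 * τ * ψ * Q') ^ p * M ^ p) * 2 :=
          mul_le_mul hL hS2 hS0 (by positivity)
      _ = A' * lam ^ max 1 (p - 1) * (2 * exp 1 * (2 * τ * ψ * Q') ^ p * M ^ p) := by ring
  -- the graded partial sums, uniformly in `N`
  set Gb : ℝ := A' * lam ^ max 1 (p - 1) * (p * exp 1 * (2 * τ * ψ * Q') ^ p * M ^ (p - 1)) +
    A' * lam ^ max 1 (p - 1) * (2 * exp 1 * (2 * τ * ψ * Q') ^ p * M ^ p) with hGb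
  have hG : ∀ N, ∑ n ∈ Icc 2 N, exp 1 * Φ ^ (n - 1) * ψ ^ p * towerS D τ μ n p ≤ Gb := by
    intro N
    rw [← sum_filter_add_sum_filter_not (Icc 2 N) (fun n => n ≤ p)]
    have hnot : (Icc 2 N).filter (fun n => ¬ n ≤ p) = (Icc 2 N).filter (fun n => p < n) := filter_congr fun n _ => by simp [not_le]
    rw [hnot]
    exact add_le_add (hlow N) (hhigh N)
  -- the tail, monotone in `V` and `→ 0`
  set Vb : ℝ := A' * lam * (exp 1 * τ * Q') * (1 + exp 1 * τ * Q' / (1 - exp 1 * τ * lam * Q')) with hVb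
  have hΦVb : Φ * Vb ≤ 1 / 2 := by
    calc Φ * Vb ≤ Φ * (A' * lam * (exp 1 * τ * Q') * (1 + 2 * (exp 1 * τ * Q'))) := by rw [hVb]; gcongr
      _ ≤ 1 / 2 := hV
  have hθb0 : 0 ≤ Φ * Vb := hθ0.trans (mul_le_mul_of_nonneg_left hVle hΦ)
  have hθblt : Φ * Vb < 1 := by linarith
  set T : ℕ → ℝ := fun N => ψ ^ p * exp 1 * Vb * (Φ * Vb) ^ N / (1 - Φ * Vb) with hT
  have hTail : ∀ N, ψ ^ p * exp 1 * V * (Φ * V) ^ N / (1 - Φ * V) ≤ T N := by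
    intro N
    have h1 : 0 < 1 - Φ * Vb := by linarith
    have h2 : 1 - Φ * Vb ≤ 1 - Φ * V := sub_le_sub_left (mul_le_mul_of_nonneg_left hVle hΦ) 1
    rw [hT]
    dsimp only
    rw [div_eq_mul_inv, div_eq_mul_inv]
    have hinv : (1 - Φ * V)⁻¹ ≤ (1 - Φ * Vb)⁻¹ := inv_anti₀ h1 h2
    have hpowN : (Φ * V) ^ N ≤ (Φ * Vb) ^ N := pow_le_pow_left₀ hθ0 (mul_le_mul_of_nonneg_left hVle hΦ) N
    have : 0 ≤ (1 - Φ * V)⁻¹ := inv_nonneg.2 (sub_nonneg.2 hθ1.le)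
    gcongr
  have hbN : ∀ N, 2 ≤ N → b ≤ A' * lam ^ max 1 (p - 1) * ((4 * Q') ^ p * (8 * σ * Q')) + Gb + T N := fun N hN =>
    (hstep N hN hθ1).trans (add_le_add_three hFO (hG N) (hTail N))
  have hTto : Filter.Tendsto T Filter.atTop (nhds 0) := by
    have h := (tendsto_pow_atTop_nhds_zero_of_lt_one hθb0 hθblt).mul_const ((1 - Φ * Vb)⁻¹) |>.const_mul (ψ ^ p * exp 1 * Vb)
    rw [zero_mul, mul_zero] at h
    refine h.congr' (Filter.Eventually.of_forall fun N => ?_)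
    rw [hT]
    dsimp only
    rw [div_eq_mul_inv]
    ring
  have hlim : Filter.Tendsto (fun N => A' * lam ^ max 1 (p - 1) * ((4 * Q') ^ p * (8 * σ * Q')) + Gb + T N) Filter.atTop
      (nhds (A' * lam ^ max 1 (p - 1) * ((4 * Q') ^ p * (8 * σ * Q')) + Gb)) := by
    have := hTto.const_add (A' * lam ^ max 1 (p - 1) * ((4 * Q') ^ p * (8 * σ * Q')) + Gb)
    rwa [add_zero] at this
  have hble : b ≤ A' * lam ^ max 1 (p - 1) * ((4 * Q') ^ p * (8 * σ * Q')) + Gb :=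
    ge_of_tendsto hlim (Filter.eventually_atTop.2 ⟨2, fun N hN => hbN N hN⟩)
  refine hble.trans (le_of_eq ?_)
  rw [hGb]
  ring

end Summit.HubbardSuperconductivity.HubbardSuperconductivity.Theorems.TwoVolumeDefect

end
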